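import Mathlib
import HarnessLib
import Summits.AtomisticToContinuum.FouriersLaw.Theses.JunctionLocality
import Summits.AtomisticToContinuum.FouriersLaw.Theorems.JunctionLocalitySuperadditiveResistanceStubProbeRemovalCostAux1
import Summits.AtomisticToContinuum.FouriersLaw.Theorems.JunctionLocalitySuperadditiveResistanceStubBypassBoundAux4
import Summits.AtomisticToContinuum.FouriersLaw.Theorems.JunctionLocalitySuperadditiveResistanceStubTerminationLocalityAux9
import Summits.AtomisticToContinuum.FouriersLaw.Theorems.JunctionLocalityConductanceLowerBoundStubFisherSquare

/-!
# Probe-removal cost in the κ-frame, helper II: Green's cross identity for TWO THERMOSTAT SETS, and the device as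
# "plain chain + probe pair" in pair form
(helper `--supports` stmt-AtomisticToContinuum-11748 for stub `stub_probeRemovalCost` (S3') of line
`floating-probe-bypass-laplacian`, skeleton v7/v8, crux `JunctionLocality.SuperadditiveResistance`)

S3' compares, `N`-uniformly and eventually in `κ → 0⁺`, the Schur variables `a = K₀₀`, `b = K₃₃`, `x = −K₀₃` of the
`κ`-resolvent Kubo matrix of the γ-probed `(N, M)`-device (`g a ∈ deviceResolventFields … (termSite N M a) κ`) with the
plain `(N+M)`-chain's Kubo conductance `G_L = plainKubo … (N+M) gL` (`gL ∈ plainForwardFields … (N+M)`). The device's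
generator is the plain chain's plus the probe-pair OU operator, `L_dev = L_pl + γ S_K` (helper I, `bathOp_deviceWeight`), so
every κ-frame comparison of the two is a Green identity between a pair of `X_H + γS_{B_pl + W_K}` and a pair of
`X_H + γS_{B_pl}` — two DIFFERENT thermostat sets on the same phase space and the same Gibbs state. This file supplies that
identity in first-order (Dirichlet) form, with every cutoff/integrability obligation discharged:

* `cross_level_addWeights` — for weights `B, W`, friction `c`, a `σ`-pair `f` of `σX_H + cS_{B+W}` (source `k_f`) and a
  `(−σ)`-pair `h` of `−σX_H + cS_B` (source `k_h`), EXACTLY at every cutoff level `n`: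
  `∫χ_n h k_f ρ − ∫χ_n f k_h ρ = cT Σ_i W_i (∫χ_n ∂_{p_i}f ∂_{p_i}h ρ + ∫ ∂_{p_i}χ_n h ∂_{p_i}f ρ)`
  `  + cT Σ_i B_i ∫ ∂_{p_i}χ_n (h∂_{p_i}f − f∂_{p_i}h) ρ`
  (the landed `Kubo.cross_level` for `f` read as a `B`-pair with source `k_f + cS_W f`, plus `Kubo.integral_chi_mul_bathOp`);
* `tendsto_cross_addWeights` — for `B, W ≥ 0`, `c > 0`, `f, h, k_f, k_h ∈ L²(μ_T)` and NO further hypothesis, the cutoff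
  Dirichlet pairings on the added thermostats CONVERGE: `cT Σ_i W_i ∫χ_n ∂_{p_i}f ∂_{p_i}h ρ → ∫ h k_f ρ − ∫ f k_h ρ`
  (`∂_{p_i}f ∈ L²` where `B_i + W_i > 0`, `∂_{p_i}h ∈ L²` where `B_i > 0`, by the landed `Kubo.memLp_partialP`);
* `cross_addWeights` — if moreover `∂_{p_i} h ∈ L²(μ_T)` on the support of `W`:
  `∫ h k_f ρ − ∫ f k_h ρ = cT Σ_i W_i ∫ ∂_{p_i}f ∂_{p_i}h ρ` (for `W = 0` this is `Kubo.cross`);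
* `deviceWeight_eq_add`, `sum_probeWeight_mul` — `B_dev = B_pl + W_K`, `W_K = 𝟙_{N−1} + 𝟙_N` (a notation, no definition);
  `deviceResolvent_pair_add`, `plainPair_rev_pair`, `integral_rev_mul_resolventSource` — the pair forms of a device
  `κ`-resolvent field and of a reversed plain pair, and the splitting of the reversed resolvent pairing.

Helper III applies this to the plain forward fields against the device resolvent fields (the four κ-frame probe-removal
identities); helper IV reduces the registered stub. Fixed-`N` statements; standard axioms; no definitions; nothing taken as
a named fact.
-/
noncomputable section

open MeasureTheory Filter Topology
open scoped ContDiff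
open Literature.MathematicalPhysics.KineticTheory.HeatConduction
open Summit.AtomisticToContinuum.FouriersLaw.Theorems.SuperadditiveResistance.DeviceLiouville
  (kin deviceGenerator deviceWeight deviceGenerator_eq kin_eq_sq liouvilleOp bathOp generator_eq_liouvilleOp_add)
open Summit.AtomisticToContinuum.FouriersLaw.Theorems.SuperadditiveResistance.Kubo
  (rev rev_apply contDiff_rev continuous_rev memLp_rev rev_pair partialP_rev_eq cross_level chi contDiff_chi
    hasCompactSupport_chi memLp_partialP integrable_mul_mul_gibbsDensity integral_rev_mul_gibbsDensity
    tendsto_integral_chi_mul tendsto_integral_partialP_chi_mul integral_chi_mul_bathOp continuous_source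
    continuous_bathOp tendsto_sum_mul)
open Summit.AtomisticToContinuum.FouriersLaw.Cruxes.ConductanceLowerBound.ForecastSensitivity
  (measurePreserving_siteReflection_gibbsMeasure kin_zero_siteReflection)
open Summit.AtomisticToContinuum.FouriersLaw.Cruxes.SuperadditiveResistance.ThermaliseThenCutProbeInsertion
  (plainField_endPairing)

namespace Summit.AtomisticToContinuum.FouriersLaw.Cruxes.SuperadditiveResistance.FloatingProbeBypassLaplacian

/-! ## §1 Green's cross identity for two thermostat sets -/

section AddWeights

variable {ω₂ lam β γ : ℝ} {L : ℕ}

/-- The thermostat operator is additive in the site weights: `S_{B+W} = S_B + S_W` pointwise. -/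
theorem bathOp_add_weights (L : ℕ) (B W : Fin L → ℝ) (T : ℝ) (f : PhaseSpace L → ℝ) (x : PhaseSpace L) :
    bathOp L (B + W) T f x = bathOp L B T f x + bathOp L W T f x := by
  unfold bathOp
  rw [← Finset.sum_add_distrib]
  refine Finset.sum_congr rfl fun i _ => ?_
  rw [Pi.add_apply]
  ring

/-- **Cross Green identity for two thermostat sets, at cutoff level (exact).** Pinned chain, `T > 0`, weights `B, W`,
friction `c`; `f ∈ C²` a `σ`-pair of `σX_H + cS_{B+W}` with source `k_f`, `h ∈ C²` a `(−σ)`-pair of `−σX_H + cS_B` with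
source `k_h`. Then for every cutoff level `n`:
`∫ χ_n h k_f ρ − ∫ χ_n f k_h ρ = cT Σ_i W_i (∫ χ_n ∂_{p_i}f ∂_{p_i}h ρ + ∫ ∂_{p_i}χ_n (h ∂_{p_i}f) ρ)
  + cT Σ_i B_i ∫ ∂_{p_i}χ_n (h ∂_{p_i}f − f ∂_{p_i}h) ρ`
(`f` is a `σ`-pair of the `B`-thermostats with source `k_f + c S_W f`: the landed `Kubo.cross_level` plus the cutoff
Dirichlet form `Kubo.integral_chi_mul_bathOp` of the added thermostats). -/
theorem cross_level_addWeights (hω : 0 < ω₂) (hl : 0 ≤ lam) (hβ : 0 ≤ β) (L : ℕ) {T : ℝ} (hT : 0 < T)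
    (B W : Fin L → ℝ) (σ c : ℝ) {f kf h kh : PhaseSpace L → ℝ} (hf : ContDiff ℝ 2 f) (hh : ContDiff ℝ 2 h)
    (hpf : ∀ x, σ * liouvilleOp (pinnedChain ω₂ lam β γ) L f x + c * bathOp L (B + W) T f x = -kf x)
    (hph : ∀ x, -σ * liouvilleOp (pinnedChain ω₂ lam β γ) L h x + c * bathOp L B T h x = -kh x) (n : ℕ) :
    (∫ x, chi (pinnedChain ω₂ lam β γ) L n x * (h x * kf x) * (pinnedChain ω₂ lam β γ).gibbsDensity L T x) -
        ∫ x, chi (pinnedChain ω₂ lam β γ) L n x * (f x * kh x) * (pinnedChain ω₂ lam β γ).gibbsDensity L T x =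
      c * T * ∑ i, W i *
          ((∫ x, chi (pinnedChain ω₂ lam β γ) L n x * (partialP i f x * partialP i h x) *
              (pinnedChain ω₂ lam β γ).gibbsDensity L T x) +
            ∫ x, partialP i (chi (pinnedChain ω₂ lam β γ) L n) x * (h x * partialP i f x) *
              (pinnedChain ω₂ lam β γ).gibbsDensity L T x) +
        c * T * ∑ i, B i * ∫ x, partialP i (chi (pinnedChain ω₂ lam β γ) L n) x *
          (h x * partialP i f x - f x * partialP i h x) * (pinnedChain ω₂ lam β γ).gibbsDensity L T x := by
  set P := pinnedChain ω₂ lam β γ with hP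
  set ρ : PhaseSpace L → ℝ := P.gibbsDensity L T with hρ
  -- `f` as a `σ`-pair of the `B`-thermostats with the probe source moved to the right
  have hpf' : ∀ x, σ * liouvilleOp P L f x + c * bathOp L B T f x = -(kf x + c * bathOp L W T f x) := by
    intro x
    have e := hpf x
    rw [bathOp_add_weights] at e
    linarith
  have hX := cross_level hω hl hβ L hT B σ c hf hh hpf' hph n
  have hS := integral_chi_mul_bathOp hω hl hβ γ L W hT.ne' hh hf n
  rw [← hP] at hX hS
  rw [← hρ] at hX hS
  -- continuity / compact support bookkeeping for splitting the first integral
  have hHs : ContDiff ℝ ∞ (P.hamiltonian L) :=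
    P.contDiff_hamiltonian (pinnedChain_contDiff_U ω₂ lam β γ) (pinnedChain_contDiff_V ω₂ lam β γ) L
  have hχcont : Continuous (chi P L n) := (contDiff_chi hHs n).continuous
  have hχc : HasCompactSupport (chi P L n) := hasCompactSupport_chi hω hl hβ γ L n
  have hfc : Continuous f := hf.continuous
  have hhc : Continuous h := hh.continuous
  have hkfc : Continuous kf := continuous_source (B + W) T σ c hf hpf
  have hSfc : Continuous (bathOp L W T f) := continuous_bathOp L W T hf
  have hρc : Continuous ρ := pinnedChain_continuous_gibbsDensity ω₂ lam β γ L T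
  have i1 : Integrable fun x => chi P L n x * (h x * kf x) * ρ x :=
    Continuous.integrable_of_hasCompactSupport (by fun_prop) hχc.mul_right.mul_right
  have i2 : Integrable fun x => chi P L n x * h x * bathOp L W T f x * ρ x :=
    Continuous.integrable_of_hasCompactSupport (by fun_prop) hχc.mul_right.mul_right.mul_right
  have hsplit : ∫ x, chi P L n x * h x * (kf x + c * bathOp L W T f x) * ρ x =
      (∫ x, chi P L n x * (h x * kf x) * ρ x) + c * ∫ x, chi P L n x * h x * bathOp L W T f x * ρ x := by
    rw [← integral_const_mul, ← integral_add i1 (i2.const_mul _)]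
    exact integral_congr_ae (ae_of_all _ fun x => by ring)
  -- reorder the integrands of the landed identities into the shapes of the statement
  have eF : ∫ x, chi P L n x * f x * kh x * ρ x = ∫ x, chi P L n x * (f x * kh x) * ρ x :=
    integral_congr_ae (ae_of_all _ fun x => by ring)
  have eI : ∀ i, ∫ x, chi P L n x * partialP i h x * partialP i f x * ρ x =
      ∫ x, chi P L n x * (partialP i f x * partialP i h x) * ρ x :=
    fun i => integral_congr_ae (ae_of_all _ fun x => by ring)
  have eU : ∀ i, ∫ x, h x * partialP i (chi P L n) x * partialP i f x * ρ x =
      ∫ x, partialP i (chi P L n) x * (h x * partialP i f x) * ρ x :=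
    fun i => integral_congr_ae (ae_of_all _ fun x => by ring)
  have eB : ∀ i, ∫ x, (h x * partialP i f x - f x * partialP i h x) * partialP i (chi P L n) x * ρ x =
      ∫ x, partialP i (chi P L n) x * (h x * partialP i f x - f x * partialP i h x) * ρ x :=
    fun i => integral_congr_ae (ae_of_all _ fun x => by ring)
  rw [hsplit, eF] at hX
  simp only [eB] at hX
  simp only [eI, eU] at hS
  linear_combination hX - c * hS

/-- **The cutoff junction Dirichlet pairings converge (no regularity hypothesis).** In the setting of
`cross_level_addWeights` with `B, W ≥ 0`, `c > 0` and `f, h, k_f, k_h ∈ L²(μ_T)`: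
`cT Σ_i W_i ∫ χ_n ∂_{p_i}f ∂_{p_i}h ρ ⟶ ∫ h k_f ρ − ∫ f k_h ρ` as `n → ∞`
(the cutoff-gradient terms vanish by dominated convergence: `∂_{p_i}f ∈ L²` wherever `B_i + W_i > 0` and
`∂_{p_i}h ∈ L²` wherever `B_i > 0`, by the landed energy estimate `Kubo.memLp_partialP`). -/
theorem tendsto_cross_addWeights (hω : 0 < ω₂) (hl : 0 ≤ lam) (hβ : 0 ≤ β) (L : ℕ) {T : ℝ} (hT : 0 < T)
    (B W : Fin L → ℝ) (hB : ∀ i, 0 ≤ B i) (hW : ∀ i, 0 ≤ W i) (σ : ℝ) {c : ℝ} (hc : 0 < c)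
    {f kf h kh : PhaseSpace L → ℝ} (hf : ContDiff ℝ 2 f) (hh : ContDiff ℝ 2 h)
    (hf2 : MemLp f 2 ((pinnedChain ω₂ lam β γ).gibbsMeasure L T))
    (hh2 : MemLp h 2 ((pinnedChain ω₂ lam β γ).gibbsMeasure L T))
    (hkf2 : MemLp kf 2 ((pinnedChain ω₂ lam β γ).gibbsMeasure L T))
    (hkh2 : MemLp kh 2 ((pinnedChain ω₂ lam β γ).gibbsMeasure L T))
    (hpf : ∀ x, σ * liouvilleOp (pinnedChain ω₂ lam β γ) L f x + c * bathOp L (B + W) T f x = -kf x)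
    (hph : ∀ x, -σ * liouvilleOp (pinnedChain ω₂ lam β γ) L h x + c * bathOp L B T h x = -kh x) :
    Tendsto (fun n : ℕ => c * T * ∑ i, W i * ∫ x, chi (pinnedChain ω₂ lam β γ) L n x *
        (partialP i f x * partialP i h x) * (pinnedChain ω₂ lam β γ).gibbsDensity L T x) atTop
      (𝓝 ((∫ x, h x * kf x * (pinnedChain ω₂ lam β γ).gibbsDensity L T x) -
        ∫ x, f x * kh x * (pinnedChain ω₂ lam β γ).gibbsDensity L T x)) := by
  set P := pinnedChain ω₂ lam β γ with hP
  set ρ : PhaseSpace L → ℝ := P.gibbsDensity L T with hρ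
  have hf1 : ContDiff ℝ 1 f := hf.of_le (by norm_cast)
  have hh1 : ContDiff ℝ 1 h := hh.of_le (by norm_cast)
  have hfc : Continuous f := hf.continuous
  have hhc : Continuous h := hh.continuous
  have hdfc : ∀ j, Continuous (partialP j f) := fun j => continuous_partialP hf1 one_ne_zero j
  have hdhc : ∀ j, Continuous (partialP j h) := fun j => continuous_partialP hh1 one_ne_zero j
  have hkfc : Continuous kf := continuous_source (B + W) T σ c hf hpf
  have hkhc : Continuous kh := continuous_source B T (-σ) c hh hph
  have hBW : ∀ i, 0 ≤ (B + W) i := fun i => by rw [Pi.add_apply]; exact add_nonneg (hB i) (hW i)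
  -- square-integrable momentum gradients at the thermostatted sites
  have hdf2 : ∀ i, 0 < (B + W) i → MemLp (partialP i f) 2 (P.gibbsMeasure L T) := fun i hi =>
    memLp_partialP hω hl hβ γ L hT (B + W) hBW σ hc hf hf2 hkf2 hpf hi
  have hdh2 : ∀ i, 0 < B i → MemLp (partialP i h) 2 (P.gibbsMeasure L T) := fun i hi =>
    memLp_partialP hω hl hβ γ L hT B hB (-σ) hc hh hh2 hkh2 hph hi
  -- the three convergent pieces
  have hI_a : Integrable fun x => h x * kf x * ρ x := integrable_mul_mul_gibbsDensity hω hl hβ γ L hT hh2 hkf2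
  have hI_b : Integrable fun x => f x * kh x * ρ x := integrable_mul_mul_gibbsDensity hω hl hβ γ L hT hf2 hkh2
  have hlim_a : Tendsto (fun n : ℕ => ∫ x, chi P L n x * (h x * kf x) * ρ x) atTop (𝓝 (∫ x, (h x * kf x) * ρ x)) :=
    tendsto_integral_chi_mul hω.le hl hβ γ L T (by fun_prop) (hI_a.congr (ae_of_all _ fun x => by ring))
  have hlim_b : Tendsto (fun n : ℕ => ∫ x, chi P L n x * (f x * kh x) * ρ x) atTop (𝓝 (∫ x, (f x * kh x) * ρ x)) :=
    tendsto_integral_chi_mul hω.le hl hβ γ L T (by fun_prop) (hI_b.congr (ae_of_all _ fun x => by ring))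
  have hlim_U : Tendsto (fun n : ℕ => c * T * ∑ i, W i * ∫ x, partialP i (chi P L n) x * (h x * partialP i f x) * ρ x)
      atTop (𝓝 (c * T * ∑ i, W i * (0 : ℝ))) := by
    refine (tendsto_sum_mul W _ _ fun i hWi => ?_).const_mul (c * T)
    have hi : 0 < (B + W) i := by
      rw [Pi.add_apply]; exact add_pos_of_nonneg_of_pos (hB i) (lt_of_le_of_ne (hW i) (Ne.symm hWi))
    exact tendsto_integral_partialP_chi_mul hω hl hβ γ L T i (by fun_prop)
      (integrable_mul_mul_gibbsDensity hω hl hβ γ L hT hh2 (hdf2 i hi))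
  have hlim_E : Tendsto (fun n : ℕ => c * T * ∑ i, B i * ∫ x, partialP i (chi P L n) x *
      (h x * partialP i f x - f x * partialP i h x) * ρ x) atTop (𝓝 (c * T * ∑ i, B i * (0 : ℝ))) := by
    refine (tendsto_sum_mul B _ _ fun i hBi => ?_).const_mul (c * T)
    have hi : 0 < B i := lt_of_le_of_ne (hB i) (Ne.symm hBi)
    have hi' : 0 < (B + W) i := by rw [Pi.add_apply]; exact add_pos_of_pos_of_nonneg hi (hW i)
    have hI : Integrable fun x => (h x * partialP i f x - f x * partialP i h x) * ρ x := by
      have := (integrable_mul_mul_gibbsDensity hω hl hβ γ L hT hh2 (hdf2 i hi')).sub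
        (integrable_mul_mul_gibbsDensity hω hl hβ γ L hT hf2 (hdh2 i hi))
      refine this.congr (ae_of_all _ fun x => ?_)
      simp only [Pi.sub_apply]; ring
    exact tendsto_integral_partialP_chi_mul hω hl hβ γ L T i (by fun_prop) hI
  -- the level identity rearranged: target_n = (a_n − b_n) − U_n − E_n
  have hlevel : ∀ n : ℕ, c * T * ∑ i, W i * ∫ x, chi P L n x * (partialP i f x * partialP i h x) * ρ x =
      ((∫ x, chi P L n x * (h x * kf x) * ρ x) - ∫ x, chi P L n x * (f x * kh x) * ρ x) -
        (c * T * ∑ i, W i * ∫ x, partialP i (chi P L n) x * (h x * partialP i f x) * ρ x) -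
        (c * T * ∑ i, B i * ∫ x, partialP i (chi P L n) x *
          (h x * partialP i f x - f x * partialP i h x) * ρ x) := by
    intro n
    have e := cross_level_addWeights hω hl hβ L hT B W σ c hf hh hpf hph n
    rw [← hP] at e
    rw [← hρ] at e
    have hsum : c * T * ∑ i, W i * ((∫ x, chi P L n x * (partialP i f x * partialP i h x) * ρ x) +
        ∫ x, partialP i (chi P L n) x * (h x * partialP i f x) * ρ x) =
        (c * T * ∑ i, W i * ∫ x, chi P L n x * (partialP i f x * partialP i h x) * ρ x) +
          (c * T * ∑ i, W i * ∫ x, partialP i (chi P L n) x * (h x * partialP i f x) * ρ x) := by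
      rw [← mul_add, ← Finset.sum_add_distrib]
      congr 1
      exact Finset.sum_congr rfl fun i _ => by ring
    rw [hsum] at e
    linarith
  have hmain := ((hlim_a.sub hlim_b).sub hlim_U).sub hlim_E
  simp only [mul_zero, Finset.sum_const_zero, sub_zero] at hmain
  exact hmain.congr fun n => (hlevel n).symm

/-- **Cross Green identity for two thermostat sets.** In the setting of `tendsto_cross_addWeights`, if moreover
`∂_{p_i} h ∈ L²(μ_T)` at every site of the added thermostats (`W_i ≠ 0`), then
`∫ h k_f ρ − ∫ f k_h ρ = cT Σ_i W_i ∫ ∂_{p_i}f ∂_{p_i}h ρ`. For `W = 0` this is the landed `Kubo.cross`. -/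
theorem cross_addWeights (hω : 0 < ω₂) (hl : 0 ≤ lam) (hβ : 0 ≤ β) (L : ℕ) {T : ℝ} (hT : 0 < T)
    (B W : Fin L → ℝ) (hB : ∀ i, 0 ≤ B i) (hW : ∀ i, 0 ≤ W i) (σ : ℝ) {c : ℝ} (hc : 0 < c)
    {f kf h kh : PhaseSpace L → ℝ} (hf : ContDiff ℝ 2 f) (hh : ContDiff ℝ 2 h)
    (hf2 : MemLp f 2 ((pinnedChain ω₂ lam β γ).gibbsMeasure L T))
    (hh2 : MemLp h 2 ((pinnedChain ω₂ lam β γ).gibbsMeasure L T))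
    (hkf2 : MemLp kf 2 ((pinnedChain ω₂ lam β γ).gibbsMeasure L T))
    (hkh2 : MemLp kh 2 ((pinnedChain ω₂ lam β γ).gibbsMeasure L T))
    (hpf : ∀ x, σ * liouvilleOp (pinnedChain ω₂ lam β γ) L f x + c * bathOp L (B + W) T f x = -kf x)
    (hph : ∀ x, -σ * liouvilleOp (pinnedChain ω₂ lam β γ) L h x + c * bathOp L B T h x = -kh x)
    (hWh : ∀ i, W i ≠ 0 → MemLp (partialP i h) 2 ((pinnedChain ω₂ lam β γ).gibbsMeasure L T)) :
    (∫ x, h x * kf x * (pinnedChain ω₂ lam β γ).gibbsDensity L T x) -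
        ∫ x, f x * kh x * (pinnedChain ω₂ lam β γ).gibbsDensity L T x =
      c * T * ∑ i, W i * ∫ x, partialP i f x * partialP i h x * (pinnedChain ω₂ lam β γ).gibbsDensity L T x := by
  set P := pinnedChain ω₂ lam β γ with hP
  set ρ : PhaseSpace L → ℝ := P.gibbsDensity L T with hρ
  have hf1 : ContDiff ℝ 1 f := hf.of_le (by norm_cast)
  have hh1 : ContDiff ℝ 1 h := hh.of_le (by norm_cast)
  have hdfc : ∀ j, Continuous (partialP j f) := fun j => continuous_partialP hf1 one_ne_zero j
  have hdhc : ∀ j, Continuous (partialP j h) := fun j => continuous_partialP hh1 one_ne_zero j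
  have hBW : ∀ i, 0 ≤ (B + W) i := fun i => by rw [Pi.add_apply]; exact add_nonneg (hB i) (hW i)
  have hdf2 : ∀ i, 0 < (B + W) i → MemLp (partialP i f) 2 (P.gibbsMeasure L T) := fun i hi =>
    memLp_partialP hω hl hβ γ L hT (B + W) hBW σ hc hf hf2 hkf2 hpf hi
  have hlim := tendsto_cross_addWeights hω hl hβ L hT B W hB hW σ hc hf hh hf2 hh2 hkf2 hkh2 hpf hph
  rw [← hP] at hlim
  rw [← hρ] at hlim
  have hlim' : Tendsto (fun n : ℕ => c * T * ∑ i, W i * ∫ x, chi P L n x * (partialP i f x * partialP i h x) * ρ x)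
      atTop (𝓝 (c * T * ∑ i, W i * ∫ x, (partialP i f x * partialP i h x) * ρ x)) := by
    refine (tendsto_sum_mul W _ _ fun i hWi => ?_).const_mul (c * T)
    have hi : 0 < (B + W) i := by
      rw [Pi.add_apply]; exact add_pos_of_nonneg_of_pos (hB i) (lt_of_le_of_ne (hW i) (Ne.symm hWi))
    exact tendsto_integral_chi_mul hω.le hl hβ γ L T (by fun_prop)
      ((integrable_mul_mul_gibbsDensity hω hl hβ γ L hT (hdf2 i hi) (hWh i hWi)).congr
        (ae_of_all _ fun x => by ring))
  exact tendsto_nhds_unique hlim hlim'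

end AddWeights

/-! ## §2 The device's thermostats = the plain chain's + the probe pair -/

section Probe

variable {N M : ℕ}

/-- The probe-pair weights are non-negative. -/
theorem probeWeight_nonneg (N M : ℕ) (i : Fin (N + M)) :
    0 ≤ (if i.val = N - 1 then (1 : ℝ) else 0) + (if i.val = N then (1 : ℝ) else 0) := by
  split_ifs <;> norm_num

/-- `deviceWeight = bathWeight + (𝟙_{N−1} + 𝟙_N)` (definitionally). -/
theorem deviceWeight_eq_add (N M : ℕ) : deviceWeight N M = OscillatorChain.bathWeight (N + M) +
    (fun i : Fin (N + M) => (if i.val = N - 1 then (1 : ℝ) else 0) + (if i.val = N then (1 : ℝ) else 0)) := by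
  funext i; rfl

/-- A site carrying a probe is `N−1` or `N`. -/
theorem eq_of_probeWeight_ne_zero (hM : 1 ≤ M) {i : Fin (N + M)}
    (hi : (if i.val = N - 1 then (1 : ℝ) else 0) + (if i.val = N then (1 : ℝ) else 0) ≠ 0) :
    i = ⟨N - 1, by omega⟩ ∨ i = ⟨N, by omega⟩ := by
  by_cases h1 : i.val = N - 1
  · exact Or.inl (Fin.ext h1)
  · by_cases h2 : i.val = N
    · exact Or.inr (Fin.ext h2)
    · exact absurd (by rw [if_neg h1, if_neg h2, add_zero]) hi

/-- Sums against the probe-pair weights pick out the two junction sites (`M ≥ 1`). -/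
theorem sum_probeWeight_mul (hM : 1 ≤ M) (F : Fin (N + M) → ℝ) :
    ∑ i : Fin (N + M), ((if i.val = N - 1 then (1 : ℝ) else 0) + (if i.val = N then (1 : ℝ) else 0)) * F i =
      F ⟨N - 1, by omega⟩ + F ⟨N, by omega⟩ := by
  simp only [add_mul, Finset.sum_add_distrib, ite_mul, one_mul, zero_mul]
  congr 1
  · rw [Finset.sum_eq_single_of_mem (⟨N - 1, by omega⟩ : Fin (N + M)) (Finset.mem_univ _)]
    · simp
    · intro b _ hb
      rw [if_neg]
      exact fun h => hb (Fin.ext h)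
  · rw [Finset.sum_eq_single_of_mem (⟨N, by omega⟩ : Fin (N + M)) (Finset.mem_univ _)]
    · simp
    · intro b _ hb
      rw [if_neg]
      exact fun h => hb (Fin.ext h)

end Probe

/-! ## §3 The master pairing: a plain pair against a device resolvent field -/

section Master

variable {ω₂ lam β γ T : ℝ} {N M : ℕ}

/-- A device `κ`-resolvent field in PAIR FORM with the split weights:
`X_H g + γ S_{B_plain + W_K} g = −((kin s − T) − κ g)`. -/
theorem deviceResolvent_pair_add (κ : ℝ) (s : ℕ) {g : PhaseSpace (N + M) → ℝ}
    (hpde : ∀ x, κ * g x - deviceGenerator (pinnedChain ω₂ lam β γ) N M (fun _ => T) g x = kin (N + M) s x - T)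
    (x : PhaseSpace (N + M)) :
    1 * liouvilleOp (pinnedChain ω₂ lam β γ) (N + M) g x +
        γ * bathOp (N + M) (OscillatorChain.bathWeight (N + M) +
          (fun i : Fin (N + M) => (if i.val = N - 1 then (1 : ℝ) else 0) + (if i.val = N then (1 : ℝ) else 0))) T g x =
      -((kin (N + M) s x - T) - κ * g x) := by
  have h := hpde x
  rw [deviceGenerator_eq, deviceWeight_eq_add] at h
  have hγ' : (pinnedChain ω₂ lam β γ).γ = γ := rfl
  rw [hγ'] at h
  linarith

/-- The momentum reversal of a plain pair with the kinetic source of site `t` is a BACKWARD plain pair with the same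
(even) source: `−X_H (h∘R) + γ S_{B_plain} (h∘R) = −(kin t − T)`. -/
theorem plainPair_rev_pair (ω₂ lam β γ T : ℝ) {L : ℕ} (t : ℕ) {h : PhaseSpace L → ℝ}
    (hpde : ∀ x, (pinnedChain ω₂ lam β γ).generator L T T h x = -(kin L t x - T)) (x : PhaseSpace L) :
    -1 * liouvilleOp (pinnedChain ω₂ lam β γ) L (rev h) x +
        γ * bathOp L (OscillatorChain.bathWeight L) T (rev h) x = -(kin L t x - T) := by
  have hpair : ∀ y, 1 * liouvilleOp (pinnedChain ω₂ lam β γ) L h y +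
      γ * bathOp L (OscillatorChain.bathWeight L) T h y = -(kin L t y - T) := by
    intro y
    rw [← hpde y, generator_eq_liouvilleOp_add]
    have : (pinnedChain ω₂ lam β γ).γ = γ := rfl
    rw [this, one_mul]
  have h := rev_pair (pinnedChain ω₂ lam β γ) (OscillatorChain.bathWeight L) T 1 γ
    (k := fun y => kin L t y - T) hpair x
  rw [h, rev_apply, kin_neg_snd]

/-- Splitting the reversed pairing with a resolvent source: `∫ (h∘R)((kin s − T) − κ g) ρ = ∫ h (kin s − T) ρ − κ ∫ (h∘R) g ρ`
(reversal invariance of `ρ dx`, evenness of the kinetic source). -/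
theorem integral_rev_mul_resolventSource (hω : 0 < ω₂) (hl : 0 ≤ lam) (hβ : 0 ≤ β) (hT : 0 < T) {L : ℕ} (κ : ℝ)
    (s : ℕ) {g h : PhaseSpace L → ℝ} (hgL : MemLp g 2 ((pinnedChain ω₂ lam β γ).gibbsMeasure L T))
    (hhc : Continuous h) (hhL : MemLp h 2 ((pinnedChain ω₂ lam β γ).gibbsMeasure L T)) :
    ∫ x, rev h x * ((kin L s x - T) - κ * g x) * (pinnedChain ω₂ lam β γ).gibbsDensity L T x =
      (∫ x, h x * (kin L s x - T) * (pinnedChain ω₂ lam β γ).gibbsDensity L T x) -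
        κ * ∫ x, h (x.1, -x.2) * g x * (pinnedChain ω₂ lam β γ).gibbsDensity L T x := by
  set P := pinnedChain ω₂ lam β γ with hP
  set ρ : PhaseSpace L → ℝ := P.gibbsDensity L T with hρ
  have hrevL : MemLp (rev h) 2 (P.gibbsMeasure L T) := memLp_rev hω hl hβ L hT hhc hhL
  have hI1 : Integrable fun x => rev h x * (kin L s x - T) * ρ x :=
    integrable_mul_mul_gibbsDensity hω hl hβ γ L hT hrevL (memLp_kin_sub hω hl hβ γ L s hT)
  have hI2 : Integrable fun x => rev h x * g x * ρ x := integrable_mul_mul_gibbsDensity hω hl hβ γ L hT hrevL hgL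
  have step : ∫ x, rev h x * ((kin L s x - T) - κ * g x) * ρ x =
      ∫ x, (rev h x * (kin L s x - T) * ρ x - κ * (rev h x * g x * ρ x)) :=
    integral_congr_ae (ae_of_all _ fun x => by ring)
  rw [step, integral_sub hI1 (hI2.const_mul κ), integral_const_mul]
  have eRev : ∫ x, rev h x * (kin L s x - T) * ρ x = ∫ x, h x * (kin L s x - T) * ρ x := by
    have e := integral_rev_mul_gibbsDensity P T (L := L) (fun x => h x * (kin L s x - T))
    have e' : (fun x => rev (fun x => h x * (kin L s x - T)) x * ρ x) = fun x => rev h x * (kin L s x - T) * ρ x := by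
      funext x; simp only [rev_apply, kin_neg_snd]
    rw [e'] at e
    exact e
  rw [eRev]
  rfl

end Master

/-- Registered helper sub-goal `helper_probeRemovalCrossAddWeights` (= `cross_addWeights` in stub form, `liouvilleOp`/`bathOp`
fully qualified): Green's cross identity for two thermostat sets. -/
theorem helper_probeRemovalCrossAddWeights : ∀ {ω₂ lam β γ : ℝ}, 0 < ω₂ → 0 ≤ lam → 0 ≤ β → ∀ (L : ℕ) {T : ℝ}, 0 < T → ∀ (B W : Fin L → ℝ), (∀ i, 0 ≤ B i) → (∀ i, 0 ≤ W i) → ∀ (σ : ℝ) {c : ℝ}, 0 < c → ∀ {f kf h kh : PhaseSpace L → ℝ}, ContDiff ℝ 2 f → ContDiff ℝ 2 h → MemLp f 2 ((pinnedChain ω₂ lam β γ).gibbsMeasure L T) → MemLp h 2 ((pinnedChain ω₂ lam β γ).gibbsMeasure L T) → MemLp kf 2 ((pinnedChain ω₂ lam β γ).gibbsMeasure L T) → MemLp kh 2 ((pinnedChain ω₂ lam β γ).gibbsMeasure L T) → (∀ x, σ * Summit.AtomisticToContinuum.FouriersLaw.Theorems.SuperadditiveResistance.DeviceLiouville.liouvilleOp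 (pinnedChain ω₂ lam β γ) L f x + c * Summit.AtomisticToContinuum.FouriersLaw.Theorems.SuperadditiveResistance.DeviceLiouville.bathOp L (B + W) T f x = -kf x) → (∀ x, -σ * Summit.AtomisticToContinuum.FouriersLaw.Theorems.SuperadditiveResistance.DeviceLiouville.liouvilleOp (pinnedChain ω₂ lam β γ) L h x + c * Summit.AtomisticToContinuum.FouriersLaw.Theorems.SuperadditiveResistance.DeviceLiouville.bathOp L B T h x = -kh x) → (∀ i, W i ≠ 0 → MemLp (partialP i h) 2 ((pinnedChain ω₂ lam β γ).gibbsMeasure L T)) → (∫ x, h x * kf x * (pinnedChain ω₂ lam β γ).gibbsDensity L T x) - ∫ x, f x * kh x * (pinnedChain ω₂ lam β γ).gibbsDensity L T x = c * T * ∑ i, W i * ∫ x, partialP i f x * partialP i h x * (pinnedChain ω₂ lam β γ).gibbsDensity L T x :=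
  @cross_addWeights

end Summit.AtomisticToContinuum.FouriersLaw.Cruxes.SuperadditiveResistance.FloatingProbeBypassLaplacian

end
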